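import Mathlib
import Literature.AlgebraicGeometry.Resolution.ReducedOfSmoothOverReduced
import HarnessLib

/-!
# Tower glue: iterated `p`-th root smoothings give a smooth factorisation
# (crux `IndSmooth.ValuativeSmoothing`, line `birth` r2, stub `stub_towerGlue`)

Stub `stub_towerGlue` of the skeleton `Lines/birth.lean` (lead reshape r2) for crux
stmt-ResolutionOfSingularities-16087. Setting: `k` a field of characteristic `p`, `K/k` a field
extension, `O` a valuation subring of `K`, `R ⊆ O` a finitely generated `k`-subalgebra of `K`.
Hypotheses: (`hroot`) ONE `p`-TH ROOT SMOOTHING for `O` — for a smooth `k`-algebra `T`, a `k`-map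
`φ : T → K` landing in `O`, `g ∈ T` and `y ∈ O` with `y ^ p = φ g`, there are a smooth `T'`,
`ψ : T → T'`, `u ∈ T'`, `χ : T' → K` landing in `O` with `χ ∘ ψ = φ`, `u ^ p = ψ g`, `χ u = y`;
(`hFT`) a FROBENIUS CHART — a smooth `k`-subalgebra `T₀ ⊆ O` of `K` with `r ^ p ^ n ∈ T₀` for all
`r ∈ R`. Conclusion: the inclusion `R ↪ O` factors `R → T → O` through a smooth `k`-algebra.

Proof.
* `exists_smooth_roots_finset` (multi-root lemma): finitely many pairs `(gᵢ ∈ T, yᵢ ∈ O)` with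
  `yᵢ ^ p = φ gᵢ` are smoothed simultaneously — induction on the finite set, applying `hroot` to
  one pair and the induction hypothesis to the transported remaining pairs, pushing the earlier
  root forward.
* `exists_smooth_iterRoots_finset`: the same with `yᵢ ^ p ^ n = φ gᵢ` and `uᵢ ^ p ^ n = ψ gᵢ`,
  by induction on `n`.
* `stub_towerGlue`: write `R = k[s]` for a finite set `s`, take `p ^ n`-th roots `w_r` of the
  `r ^ p ^ n ∈ T₀` hitting `r`, for `r ∈ s`, in a smooth `T₁` with `ψ₀ : T₀ → T₁`, `χ : T₁ → O`.
  The substitution `P ↦ P(w)` on `MvPolynomial s k` kills the kernel of the presentation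
  `P ↦ P(r)` of `R`: if `P(r) = 0` then `P(w) ^ p ^ n = P^σ(w ^ p ^ n) = ψ₀ (P^σ(r ^ p ^ n))`
  (`σ = Frobⁿ` on coefficients) and `P^σ(r ^ p ^ n) = P(r) ^ p ^ n = 0` holds in `T₀ ⊆ K`; as
  `T₁` is reduced (smooth over a field), `P(w) = 0`. So `P(r) ↦ P(w)` is a well defined `k`-map
  `ψ : R → T₁` (`AlgHom.liftOfSurjective`) with `χ (ψ r) = r`.
-/

-- single-problem summit: the doubled namespace component is forced
set_option linter.dupNamespace false

namespace Summit.ResolutionOfSingularities.ResolutionOfSingularities.Theorems.ValuativeSmoothing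

/-- **Frobenius pushed through a substitution.** Over a ring `k` of exponential characteristic
`p`, for a `k`-algebra `A` of exponential characteristic `p` and `P ∈ k[Xᵢ]`:
`P(v) ^ p ^ n = P^σ(v')` whenever `v' i = v i ^ p ^ n`, where `P^σ(v')` is the evaluation of `P`
at `v'` along `algebraMap ∘ Frobⁿ`. [folklore] -/
theorem aeval_pow_expChar_pow_eq_eval₂ {p : ℕ} {k A σ : Type*} [CommRing k] [ExpChar k p]
    [CommRing A] [Algebra k A] [ExpChar A p] (n : ℕ) (v v' : σ → A)
    (hv : ∀ i, v i ^ p ^ n = v' i) (P : MvPolynomial σ k) :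
    MvPolynomial.aeval v P ^ p ^ n =
      MvPolynomial.eval₂ ((algebraMap k A).comp (iterateFrobenius k p n)) v' P := by
  rw [← iterateFrobenius_def p n (MvPolynomial.aeval v P), MvPolynomial.aeval_def,
    MvPolynomial.eval₂_comp_left]
  congr 1
  · ext x
    simp [iterateFrobenius_def]
  · funext i
    simp [iterateFrobenius_def, hv]

/-- **Twisted evaluation commutes with `k`-algebra maps**: `f (P^σ(v)) = P^σ(f ∘ v)` for a
`k`-algebra map `f : A → B`, where `P^σ(v)` is the evaluation of `P ∈ k[Xᵢ]` at `v` along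
`algebraMap ∘ Frobⁿ`. [folklore] -/
theorem algHom_eval₂_iterateFrobenius {p : ℕ} {k A B σ : Type*} [CommRing k] [ExpChar k p]
    [CommRing A] [Algebra k A] [CommRing B] [Algebra k B] (f : A →ₐ[k] B) (n : ℕ) (v : σ → A)
    (P : MvPolynomial σ k) :
    f (MvPolynomial.eval₂ ((algebraMap k A).comp (iterateFrobenius k p n)) v P) =
      MvPolynomial.eval₂ ((algebraMap k B).comp (iterateFrobenius k p n)) (fun i => f (v i)) P := by
  have h := MvPolynomial.eval₂_comp_left (f : A →+* B)
    ((algebraMap k A).comp (iterateFrobenius k p n)) v P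
  rw [← RingHom.comp_assoc, AlgHom.comp_algebraMap, RingHom.coe_coe] at h
  exact h

/-- **Multi-root lemma.** Given one `p`-th root smoothing for `O` (`hroot`), finitely many pairs
`(g i ∈ T, y i ∈ O)`, `i ∈ s`, over a smooth `k`-algebra `T` mapping to `O` by `φ`, with
`y i ^ p = φ (g i)`, are smoothed simultaneously: there are a smooth `T'`, `ψ : T → T'`,
`χ : T' → K` landing in `O` with `χ ∘ ψ = φ`, and `u i ∈ T'` with `u i ^ p = ψ (g i)`,
`χ (u i) = y i`. Induction on `s`: smooth one pair by `hroot`, then the transported remaining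
pairs by the induction hypothesis, and push the first root forward. [folklore] -/
theorem exists_smooth_roots_finset {p : ℕ} {k K : Type} [Field k] [Field K] [Algebra k K]
    {O : ValuationSubring K}
    (hroot : ∀ (T : Type) [CommRing T] [Algebra k T], Algebra.Smooth k T →
      ∀ φ : T →ₐ[k] K, (∀ t : T, φ t ∈ O) → ∀ (g : T) (y : K), y ∈ O → y ^ p = φ g →
        ∃ (T' : Type) (_ : CommRing T') (_ : Algebra k T'), Algebra.Smooth k T' ∧
          ∃ (ψ : T →ₐ[k] T') (u : T') (χ : T' →ₐ[k] K),
            (∀ t : T', χ t ∈ O) ∧ (∀ t : T, χ (ψ t) = φ t) ∧ u ^ p = ψ g ∧ χ u = y)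
    {ι : Type} (s : Finset ι) :
    ∀ (T : Type) [CommRing T] [Algebra k T], Algebra.Smooth k T →
      ∀ φ : T →ₐ[k] K, (∀ t : T, φ t ∈ O) → ∀ (g : ι → T) (y : ι → K),
        (∀ i ∈ s, y i ∈ O) → (∀ i ∈ s, y i ^ p = φ (g i)) →
        ∃ (T' : Type) (_ : CommRing T') (_ : Algebra k T'), Algebra.Smooth k T' ∧
          ∃ (ψ : T →ₐ[k] T') (u : ι → T') (χ : T' →ₐ[k] K),
            (∀ t : T', χ t ∈ O) ∧ (∀ t : T, χ (ψ t) = φ t) ∧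
            (∀ i ∈ s, u i ^ p = ψ (g i)) ∧ (∀ i ∈ s, χ (u i) = y i) := by
  classical
  induction s using Finset.induction_on with
  | empty =>
    intro T _ _ hT φ hφ g y _ _
    exact ⟨T, inferInstance, inferInstance, hT, AlgHom.id k T, fun _ => 0, φ, hφ, fun _ => rfl,
      fun i hi => absurd hi (Finset.notMem_empty i), fun i hi => absurd hi (Finset.notMem_empty i)⟩
  | insert a s ha ih =>
    intro T _ _ hT φ hφ g y hyO hyp
    -- smooth the pair at `a`
    obtain ⟨T₁, _, _, hT₁, ψ₁, u₁, χ₁, hχ₁O, hχ₁ψ₁, hu₁, hχ₁u₁⟩ :=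
      hroot T hT φ hφ (g a) (y a) (hyO a (Finset.mem_insert_self a s))
        (hyp a (Finset.mem_insert_self a s))
    -- smooth the transported remaining pairs over `T₁`
    obtain ⟨T₂, _, _, hT₂, ψ₂, u₂, χ₂, hχ₂O, hχ₂ψ₂, hu₂, hχ₂u₂⟩ :=
      ih T₁ hT₁ χ₁ hχ₁O (fun i => ψ₁ (g i)) y (fun i hi => hyO i (Finset.mem_insert_of_mem hi))
        (fun i hi => by rw [hχ₁ψ₁]; exact hyp i (Finset.mem_insert_of_mem hi))
    refine ⟨T₂, inferInstance, inferInstance, hT₂, ψ₂.comp ψ₁,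
      fun i => if i = a then ψ₂ u₁ else u₂ i, χ₂, hχ₂O,
      fun t => by rw [AlgHom.comp_apply, hχ₂ψ₂, hχ₁ψ₁], ?_, ?_⟩
    · intro i hi
      rcases Finset.mem_insert.mp hi with rfl | hi
      · simp only [if_true, AlgHom.comp_apply]
        rw [← map_pow, hu₁]
      · have hne : i ≠ a := fun h => ha (h ▸ hi)
        simp only [hne, if_false, AlgHom.comp_apply]
        exact hu₂ i hi
    · intro i hi
      rcases Finset.mem_insert.mp hi with rfl | hi
      · simp only [if_true]
        rw [hχ₂ψ₂, hχ₁u₁]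
      · have hne : i ≠ a := fun h => ha (h ▸ hi)
        simp only [hne, if_false]
        exact hχ₂u₂ i hi

/-- **Iterated multi-root lemma.** As `exists_smooth_roots_finset`, with `p ^ n`-th powers:
pairs `(g i ∈ T, y i ∈ O)`, `i ∈ s`, with `y i ^ p ^ n = φ (g i)` are smoothed simultaneously,
with `u i ^ p ^ n = ψ (g i)` and `χ (u i) = y i`. Induction on `n`: first adjoin `p`-th roots of
the `g i` hitting `y i ^ p ^ (n - 1)`, then recurse. [folklore] -/
theorem exists_smooth_iterRoots_finset {p : ℕ} {k K : Type} [Field k] [Field K] [Algebra k K]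
    {O : ValuationSubring K}
    (hroot : ∀ (T : Type) [CommRing T] [Algebra k T], Algebra.Smooth k T →
      ∀ φ : T →ₐ[k] K, (∀ t : T, φ t ∈ O) → ∀ (g : T) (y : K), y ∈ O → y ^ p = φ g →
        ∃ (T' : Type) (_ : CommRing T') (_ : Algebra k T'), Algebra.Smooth k T' ∧
          ∃ (ψ : T →ₐ[k] T') (u : T') (χ : T' →ₐ[k] K),
            (∀ t : T', χ t ∈ O) ∧ (∀ t : T, χ (ψ t) = φ t) ∧ u ^ p = ψ g ∧ χ u = y)
    {ι : Type} (s : Finset ι) (n : ℕ) :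
    ∀ (T : Type) [CommRing T] [Algebra k T], Algebra.Smooth k T →
      ∀ φ : T →ₐ[k] K, (∀ t : T, φ t ∈ O) → ∀ (g : ι → T) (y : ι → K),
        (∀ i ∈ s, y i ∈ O) → (∀ i ∈ s, y i ^ p ^ n = φ (g i)) →
        ∃ (T' : Type) (_ : CommRing T') (_ : Algebra k T'), Algebra.Smooth k T' ∧
          ∃ (ψ : T →ₐ[k] T') (u : ι → T') (χ : T' →ₐ[k] K),
            (∀ t : T', χ t ∈ O) ∧ (∀ t : T, χ (ψ t) = φ t) ∧
            (∀ i ∈ s, u i ^ p ^ n = ψ (g i)) ∧ (∀ i ∈ s, χ (u i) = y i) := by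
  induction n with
  | zero =>
    intro T _ _ hT φ hφ g y _ hyp
    exact ⟨T, inferInstance, inferInstance, hT, AlgHom.id k T, g, φ, hφ, fun _ => rfl,
      fun i _ => by simp, fun i hi => by simpa using (hyp i hi).symm⟩
  | succ n ih =>
    intro T _ _ hT φ hφ g y hyO hyp
    -- `p`-th roots of the `g i` hitting `y i ^ p ^ n`
    obtain ⟨T₁, _, _, hT₁, ψ₁, u₁, χ₁, hχ₁O, hχ₁ψ₁, hu₁, hχ₁u₁⟩ :=
      exists_smooth_roots_finset hroot s T hT φ hφ g (fun i => y i ^ p ^ n)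
        (fun i hi => pow_mem (hyO i hi) _)
        (fun i hi => by rw [← pow_mul, ← pow_succ]; exact hyp i hi)
    -- `p ^ n`-th roots of the `u₁ i` hitting `y i`
    obtain ⟨T₂, _, _, hT₂, ψ₂, u₂, χ₂, hχ₂O, hχ₂ψ₂, hu₂, hχ₂u₂⟩ :=
      ih T₁ hT₁ χ₁ hχ₁O u₁ y hyO (fun i hi => (hχ₁u₁ i hi).symm)
    refine ⟨T₂, inferInstance, inferInstance, hT₂, ψ₂.comp ψ₁, u₂, χ₂, hχ₂O,
      fun t => by rw [AlgHom.comp_apply, hχ₂ψ₂, hχ₁ψ₁], fun i hi => ?_, hχ₂u₂⟩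
    rw [pow_succ, pow_mul, hu₂ i hi, ← map_pow, hu₁ i hi, AlgHom.comp_apply]

/-- **Stub `stub_towerGlue` (line `birth` r2, crux `IndSmooth.ValuativeSmoothing`).** For `k`
of characteristic `p`, a valuation subring `O` of the extension field `K`, and a finitely
generated `k`-subalgebra `R ⊆ O`: one `p`-th root smoothing for `O` (`hroot`) and a Frobenius
chart for `R` (`hFT`: a smooth `k`-subalgebra `T₀ ⊆ O` with `r ^ p ^ n ∈ T₀` for `r ∈ R`) give a
factorisation `R → T → O` of the inclusion through a smooth `k`-algebra `T`. Adjoin `p ^ n`-th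
roots `w_r ↦ r` of the `r ^ p ^ n`, `r` running over generators of `R`
(`exists_smooth_iterRoots_finset`); the substitution `P ↦ P(w)` vanishes on the relations of the
generators since `P(w) ^ p ^ n = ψ₀(P^σ(r ^ p ^ n)) = ψ₀(P(r) ^ p ^ n) = 0` is computed in
`T₀ ⊆ K` and smooth algebras over fields are reduced
(`Literature.AlgebraicGeometry.Motives.isReduced_of_smooth_of_field`). [folklore] -/
theorem stub_towerGlue (p : ℕ) (hp : p.Prime)
    (k K : Type) [Field k] [CharP k p] [PerfectField k] [Field K] [Algebra k K]
    (O : ValuationSubring K) (R : Subalgebra k K) (hR : R.FG) (hRO : R.toSubring ≤ O.toSubring)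
    (hroot : ∀ (T : Type) [CommRing T] [Algebra k T], Algebra.Smooth k T →
      ∀ φ : T →ₐ[k] K, (∀ t : T, φ t ∈ O) → ∀ (g : T) (y : K), y ∈ O → y ^ p = φ g →
        ∃ (T' : Type) (_ : CommRing T') (_ : Algebra k T'), Algebra.Smooth k T' ∧
          ∃ (ψ : T →ₐ[k] T') (u : T') (χ : T' →ₐ[k] K),
            (∀ t : T', χ t ∈ O) ∧ (∀ t : T, χ (ψ t) = φ t) ∧ u ^ p = ψ g ∧ χ u = y)
    (hFT : ∃ (n : ℕ) (T : Subalgebra k K), T.toSubring ≤ O.toSubring ∧ Algebra.Smooth k T ∧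
      ∀ r : K, r ∈ R → r ^ p ^ n ∈ T) :
    ∃ (T : Type) (_ : CommRing T) (_ : Algebra k T), Algebra.Smooth k T ∧
      ∃ (ψ : R →ₐ[k] T) (χ : T →ₐ[k] K), (∀ t : T, χ t ∈ O) ∧ ∀ r : R, χ (ψ r) = (r : K) := by
  classical
  obtain ⟨s, hs⟩ := hR
  obtain ⟨n, T₀, hT₀O, hT₀, hpow⟩ := hFT
  have hsR : ∀ x ∈ s, x ∈ R := fun x hx => by
    rw [← hs]; exact Algebra.subset_adjoin (Finset.mem_coe.mpr hx)
  -- `p ^ n`-th roots `w i ↦ i` of the `i ^ p ^ n ∈ T₀`, `i ∈ s`, in a smooth `T₁` over `T₀`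
  let g : {x // x ∈ s} → T₀ := fun i => ⟨(i : K) ^ p ^ n, hpow i (hsR i i.2)⟩
  obtain ⟨T₁, _, _, hT₁, ψ₀, w, χ, hχO, hχψ₀, hw, hχw⟩ :=
    exists_smooth_iterRoots_finset hroot s.attach n T₀ hT₀ T₀.val
      (fun t => show (t : K) ∈ O from hT₀O t.2) g (fun i => (i : K))
      (fun i _ => show (i : K) ∈ O from hRO (hsR i i.2)) (fun i _ => rfl)
  -- characteristic and reducedness bookkeeping
  haveI : ExpChar k p := ExpChar.prime hp
  haveI : Nontrivial T₁ := χ.toRingHom.domain_nontrivial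
  haveI : ExpChar T₁ p := expChar_of_injective_algebraMap (algebraMap k T₁).injective p
  haveI : ExpChar K p := expChar_of_injective_algebraMap (algebraMap k K).injective p
  haveI : Algebra.Smooth k T₁ := hT₁
  haveI : IsReduced T₁ := Literature.AlgebraicGeometry.Motives.isReduced_of_smooth_of_field k T₁
  -- the substitution `P ↦ P(w)` kills the relations of the generators `s` of `R`
  have hkey : ∀ P : MvPolynomial {x // x ∈ s} k,
      MvPolynomial.aeval (fun i : {x // x ∈ s} => (i : K)) P = 0 → MvPolynomial.aeval w P = 0 := by
    intro P hP
    -- `P^σ(g) = 0` in `T₀`, computed in `K`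
    have he : MvPolynomial.eval₂ ((algebraMap k T₀).comp (iterateFrobenius k p n)) g P = 0 := by
      have h1 := algHom_eval₂_iterateFrobenius (p := p) T₀.val n g P
      rw [← aeval_pow_expChar_pow_eq_eval₂ n (fun i : {x // x ∈ s} => (i : K))
        (fun i => T₀.val (g i)) (fun i => rfl) P, hP, zero_pow (pow_ne_zero n hp.ne_zero)] at h1
      exact Subtype.ext h1
    have h2 : MvPolynomial.aeval w P ^ p ^ n = 0 := by
      rw [aeval_pow_expChar_pow_eq_eval₂ n w (fun i => ψ₀ (g i))
        (fun i => hw i (Finset.mem_attach s i)) P,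
        ← algHom_eval₂_iterateFrobenius (p := p) ψ₀ n g P, he, map_zero]
    exact IsNilpotent.eq_zero ⟨p ^ n, h2⟩
  -- the presentation `P ↦ P(i)` of `R = k[s]`
  have hrange : (MvPolynomial.aeval (fun i : {x // x ∈ s} => (i : K)) :
      MvPolynomial {x // x ∈ s} k →ₐ[k] K).range = R := by
    rw [← Algebra.adjoin_range_eq_range_aeval, ← hs]
    congr 1
    ext x
    simp
  have hmem : ∀ P, MvPolynomial.aeval (fun i : {x // x ∈ s} => (i : K)) P ∈ R := fun P => by
    rw [← hrange]; exact (AlgHom.mem_range _).mpr ⟨P, rfl⟩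
  let F : MvPolynomial {x // x ∈ s} k →ₐ[k] R :=
    (MvPolynomial.aeval (fun i : {x // x ∈ s} => (i : K))).codRestrict R hmem
  have hF : ∀ P, (F P : K) = MvPolynomial.aeval (fun i : {x // x ∈ s} => (i : K)) P :=
    fun P => rfl
  have hFsurj : Function.Surjective F := by
    intro x
    have hx : (x : K) ∈ (MvPolynomial.aeval (fun i : {x // x ∈ s} => (i : K)) :
        MvPolynomial {x // x ∈ s} k →ₐ[k] K).range := by
      rw [hrange]; exact x.2
    obtain ⟨P, hP⟩ := (AlgHom.mem_range _).mp hx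
    exact ⟨P, Subtype.ext hP⟩
  have hker : RingHom.ker F.toRingHom ≤ RingHom.ker (MvPolynomial.aeval w).toRingHom := by
    intro P hP
    have h0 : F P = 0 := (RingHom.mem_ker).mp hP
    exact (RingHom.mem_ker).mpr (hkey P (by rw [← hF P, h0]; rfl))
  -- the factorisation
  refine ⟨T₁, inferInstance, inferInstance, hT₁,
    AlgHom.liftOfSurjective F hFsurj (MvPolynomial.aeval w) hker, χ, hχO, fun r => ?_⟩
  obtain ⟨P, rfl⟩ := hFsurj r
  rw [AlgHom.liftOfSurjective_apply, hF P, MvPolynomial.comp_aeval_apply]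
  congr 2
  funext i
  exact hχw i (Finset.mem_attach s i)

end Summit.ResolutionOfSingularities.ResolutionOfSingularities.Theorems.ValuativeSmoothing
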